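import Summits.BirchSwinnertonDyer.BirchSwinnertonDyer.Theorems.SchneiderFreeAdditiveX3LeafOfLZZMatch
import Summits.BirchSwinnertonDyer.BirchSwinnertonDyer.Theorems.SchneiderFreeAdditiveX3GordTwoBranchIMCSliverVoidModThree
import HarnessLib

/-!
# Route `SchneiderFreeAdditiveX3` (K1 door), crux r3: the (G-ord, `e = 2`) LOWER socket at `p ≢ 1 (mod 3)` — in particular at
# `p = 3` and `p = 5`, the bulk of the census — from NAMED PUBLISHED / PREPRINT FACTS ONLY, with NO scope condition and NO sliver

Cell `bsd-schneider-ideate`, seat `bsd-schneider-door-c5` (prover, generation 20; assembly layer).  PARTITION: board row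
B6 ∩ X3 ∩ sst-twist, `r = 1`, (G-ord, `e = 2`) half (2 560 pairs; 2 542 of them at `p ∈ {3, 5}`), of `Rank1Residual.partition`;
types-the-object-of nothing new; closes none of B6's cells (BSD NOT advanced).  bears_on: K1-door (items 18971/18972 → 19177 r3).

The by-name form of crux r3 on the LZZ/♭ road (`gordTwoBranchIMC_of_printedFacts_of_hsieh_of_lzz_of_KY_of_castellaHsieh_signed`,
`…LeafOfLZZMatch`, p639417) still carries the `d_K = −3` sliver `KYReadSliver` (Keller–Yin's Assumption 2.0.3) and, through it,
Cai–Shu–Tian Thm. 1.1.  But a Heegner field with `d_K = −3` and a degree-one prime above `p` with `p ∤ #𝓞_K^×` forces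
`p ≡ 1 (mod 3)` (`mod_three_eq_one_of_degreeOne_of_discr_eq_neg_three`, door-c3): so at every `p ≢ 1 (mod 3)` the sliver is VOID and
the off-sliver socket of `…LeafOfLZZMatch` §3 is the WHOLE socket.  Compared with p631992's
`additiveIMCLowerBDPInputManinAt_gordTwo_scope_of_print_of_mod_three_ne_one` (Castella–Hsieh's print scope `¬ p² ∣ φ(N_W)`,
the scoped signed VALUE fact, Cai–Shu–Tian, CM-rationality): NO scope hypothesis, and the inputs are Kolyvagin ∧ modularity ∧
Hsieh 2014 Thm. A ∧ Liu–Zhang–Zhang 2018 ∧ Keller–Yin Thm. 3.5.1 ×3 (PREPRINT) ∧ Castella–Hsieh signed existence — nothing else.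

HONEST FRAMING: THEOREMS ONLY; a three-line composition of tree theorems; CONDITIONAL on the displayed hypotheses (Keller–Yin is an
unrefereed PREPRINT); nothing is closed; BSD is proved for no curve; «closes rung: none».
References: [KellerYin2024b] arXiv:2410.23241 Thm. 3.5.1, Assumption 2.0.3 (preprint); [CastellaHsieh2018] §3.3, Def. 3.7, Prop. 3.8;
[Hsieh2014] Thm. A; [LiuZhangZhang2018] Thm 1.5.1/1.5.3; [HardyWright2008] Thm 96 (cubic residues; the `p ≡ 1 (3)` splitting).
-/

set_option autoImplicit false
-- `Summit.<P>.<Sub>` repeats `BirchSwinnertonDyer` by the tree's layout convention (D-0017)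
set_option linter.dupNamespace false

noncomputable section

open scoped Classical NumberField

open Field NumberField IsDedekindDomain WeierstrassCurve
  Literature.NumberTheory.EllipticCurves Literature.NumberTheory.EllipticCurves.ModularForms
  Literature.NumberTheory.EllipticCurves.Rank1Residual Literature.NumberTheory.EllipticCurves.KellerYin2024
  Summit.BirchSwinnertonDyer.Rank1Residual
  Summit.BirchSwinnertonDyer.BirchSwinnertonDyer.Theorems.SchneiderFree
  Summit.BirchSwinnertonDyer.BirchSwinnertonDyer.Theses.SchneiderFreeAdditiveX3

namespace Summit.BirchSwinnertonDyer.BirchSwinnertonDyer.Theorems.SchneiderFreeAdditiveX3.ControlDischarged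

/-- **The (G-ord, `e = 2`) lower socket `AdditiveIMCLowerBDPInputManinAt W p` at every `p ≢ 1 (mod 3)` (so at `p = 3` and `p = 5`)
from NAMED FACTS ONLY, with NO scope condition and NO sliver** ⇐ Kolyvagin ∧ modularity ∧ Hsieh 2014 Thm. A ∧ Liu–Zhang–Zhang 2018 ∧
Keller–Yin Thm. 3.5.1 ×3 (PREPRINT) ∧ Castella–Hsieh signed existence: at such `p` no Heegner datum of the socket has `d_K = −3`
(`mod_three_eq_one_of_degreeOne_of_discr_eq_neg_three`), so `…LeafOfLZZMatch`'s off-sliver socket applies to every datum.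
CONDITIONAL on the named facts; closes no item; BSD NOT advanced.
[cite: KellerYin2024b, Thm. 3.5.1 and Assumption 2.0.3 (arXiv:2410.23241 pp. 8, 20) (preprint; hypotheses)]
[cite: CastellaHsieh2018, §3.3, Def. 3.7 and Prop. 3.8] [cite: Hsieh2014, Thm. A p. 712 (Doc. Math. 19)]
[cite: LiuZhangZhang2018, Thm 1.5.1 and Thm 1.5.3 (Duke Math. J. 167 pp. 748–749)] [cite: HardyWright2008, Thm 96] -/
theorem additiveIMCLowerBDPInputManinAt_gordTwo_of_hsieh_of_lzz_of_KY_of_castellaHsieh_signed_of_mod_three_ne_one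
    (hKo : ∀ (N : ℕ) [NeZero N] (W : WeierstrassCurve ℚ) (K : Type) [Field K] [NumberField K],
      Literature.NumberTheory.EllipticCurves.kolyvagin N W K)
    (hPar : nonempty_modularParametrizationData)
    (hA : Hsieh2014.thmA_exists_isHsiehLFunction_unrPeriod_anyLevel)
    (hL : LiuZhangZhang2018.thm151_thm153_modularCurve_heegnerVector_additive)
    (hKY : thm351_imc_isTorsion_mu_zero_charIdeal_eq_OPEN) (hKYb : thm351_charIdeal_eq_branch_OPEN)
    (hKYμ : thm351_mu_zero_branch_OPEN) (hCHσ : castellaHsieh2018_exists_isBranchBDPLFunction_signed) :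
    ∀ (W : WeierstrassCurve ℚ) [W.IsElliptic] [W.IsGloballyMinimal] (p : ℕ) [Fact p.Prime],
      W.analyticRank = 1 → p ≠ 2 → ClassX3 W p → Additive.SubGordTwo W p → p % 3 ≠ 1 →
        AdditiveIMCLowerBDPInputManinAt W p := by
  intro W _ _ p _ hr hp2 hX hS hp3 N _ K _ _ Dt H ι P hr' hloc hN hK hodd hunit hHe hL1 hP hnt κ hκ γ _ 𝔭 h𝔭 he hf
  have hdK : NumberField.discr K ≠ -3 := fun hd ↦
    hp3 (mod_three_eq_one_of_degreeOne_of_discr_eq_neg_three hK hd hunit h𝔭 he hf)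
  exact additiveIMCLowerBDPOnTree_subGordTwo_offSliver_of_hsieh_of_lzz_of_KY_of_castellaHsieh_signed hKo hPar hA hL hKY hKYb
    hKYμ hCHσ W p hr hp2 hX hS N K Dt H ι P hr' hloc hN hK hodd hunit hHe hL1 hP hnt hdK κ hκ γ 𝔭 h𝔭 he hf

/-- **The same in the route file's vocabulary** (`PrintedFacts` conjuncts 2 and 5 consumed): at `p ≢ 1 (mod 3)` the door's crux r3
reads `PrintedFacts → Hsieh2014.thmA… → LiuZhangZhang2018.thm151… → thm351_OPEN → thm351_charIdeal_eq_branch_OPEN →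
thm351_mu_zero_branch_OPEN → castellaHsieh2018_exists_isBranchBDPLFunction_signed → (socket)` with NO sliver and NO Cai–Shu–Tian.
CONDITIONAL; closes no item; BSD NOT advanced. [cite: KellerYin2024b, Thm. 3.5.1 (arXiv:2410.23241 p. 20) (preprint; hypotheses)]
[cite: CastellaHsieh2018, §3.3, Def. 3.7 and Prop. 3.8] -/
theorem additiveIMCLowerBDPInputManinAt_gordTwo_of_printedFacts_of_hsieh_of_lzz_of_KY_of_castellaHsieh_signed_of_mod_three_ne_one
    (hF : PrintedFacts) (hA : Hsieh2014.thmA_exists_isHsiehLFunction_unrPeriod_anyLevel)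
    (hL : LiuZhangZhang2018.thm151_thm153_modularCurve_heegnerVector_additive)
    (hKY : thm351_imc_isTorsion_mu_zero_charIdeal_eq_OPEN) (hKYb : thm351_charIdeal_eq_branch_OPEN)
    (hKYμ : thm351_mu_zero_branch_OPEN) (hCHσ : castellaHsieh2018_exists_isBranchBDPLFunction_signed) :
    ∀ (W : WeierstrassCurve ℚ) [W.IsElliptic] [W.IsGloballyMinimal] (p : ℕ) [Fact p.Prime],
      W.analyticRank = 1 → p ≠ 2 → ClassX3 W p → Additive.SubGordTwo W p → p % 3 ≠ 1 →
        AdditiveIMCLowerBDPInputManinAt W p := by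
  obtain ⟨-, hKo, -, -, hPar, -⟩ := id hF
  exact additiveIMCLowerBDPInputManinAt_gordTwo_of_hsieh_of_lzz_of_KY_of_castellaHsieh_signed_of_mod_three_ne_one hKo hPar hA
    hL hKY hKYb hKYμ hCHσ

end Summit.BirchSwinnertonDyer.BirchSwinnertonDyer.Theorems.SchneiderFreeAdditiveX3.ControlDischarged

end
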